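import Summits.AtomisticToContinuum.Crystallization.Theses.PricedLinkCensus
import Summits.AtomisticToContinuum.Crystallization.Theorems.PricedLinkCensusTruncatedCensusGapPeriodicStability
import Summits.AtomisticToContinuum.Crystallization.Theorems.PricedLinkCensusTruncatedCensusGapBarlowWindowLink
import Summits.AtomisticToContinuum.Crystallization.Theorems.PricedLinkCensusTruncatedCensusGapChargeFreeOpenAtGerm
import Summits.AtomisticToContinuum.Crystallization.Theorems.PricedLinkCensusTruncatedCensusGapKnabeCompactness

/-!
# Line `frustration-free-census-germ` — checked skeleton for crux `TruncatedCensusGap` (reshape r3)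

Crux item `stmt-AtomisticToContinuum-14230` (route `PricedLinkCensus`, rank 2):

  `TruncatedCensusGap : ∃ κ > 0, ∀ N (y : Fin N → ℝ³) injective,`
  `    N · e_χ* + κ · #{i | ¬ IsChargeFree (1/100) y i} ≤ E_χ(y)`,

`V_χ = min 1 (max 0 (4 − 2r)) · V_LJ` (range 2), `E_χ = interactionEnergy V_χ`,
`e_χ* = ⨅_Q e_χ(Q)` over `PeriodicConfiguration 3`.

## The line (idea `frustration-free-census-germ`, crux-ideate k2; triage r1-1 / r1-3 pass)

LEVER.  An EXACT reapportioning of the pair energy into local STAR FORMS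
`h_i(y) = Σ_{j<k} w_i(j,k;y) · V_χ(|y_j − y_k|) − e₀ · Σ_j μ_i(j;y)` with unit-sum non-negative weights,
chosen FRUSTRATION-FREE (`h_i ≥ 0`, zero set = rigid images of perfect close-packed germs); then a
Knabe-type compactness turns local positivity off the germ into a uniform price `κ(δ)` at every site
that is not `δ`-germ-matched, and charged sites are not `(1/1000)`-germ-matched (open margin).

RESHAPE r2 (lead prover-line-…-14230-0, 2026-08-16): self-contained stub signatures; window-link split;
spacing window `±1/250`; four of five stubs LANDED (p84999 `stub_periodicStability`, p85249
`stub_barlowWindowLink`, p85261 `stub_chargeFreeOpenAtGerm`, p85371 `stub_knabeCompactness`), leaving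
`stub_frustrationFreeStars` (XL) as the only `sorry`; lead -0 ended with promote-stub (REPORT-final.md).

RESHAPE r3 (continuation lead prover-line-…-14230-c1-0, 2026-08-16, THIS FILE).  With stubs 1, 3, 4, 5 in
the tree, what the composition actually CONSUMES from the XL stub is only its consequence

  `MetricDefectGap : ∃ κ > 0, ∀ N y injective, N · e_χ* + κ · #{i | ¬ GermMatched (1/1000) y i} ≤ E_χ(y)`

— the crux with "charged at tolerance 1/100" replaced by the METRIC defect notion "not two-way
`(a/1000)`-matched within `3a` to a rigid Barlow germ" (the landed open margin makes every charged site a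
metric defect, so `MetricDefectGap → TruncatedCensusGap` in five lines, `TruncatedCensusGap_of`).  The single
registered stub is therefore now `stub_metricDefectGap`, which is STRICTLY WEAKER than r2's
`stub_frustrationFreeStars`: it is measured against `e_χ*` itself (no attained periodic minimiser `Q₀`
is asserted), it asks for no weights, no site functional, no locality radius, no semicontinuity and no
crowding floor, and it is implied by the r2 stub through the landed Knabe compactness and the exactness
of star forms — PROVED here as the bridge chain
`FrustrationFreeStars → LocalEnergyInequality → MetricDefectGap` (§5,
`localEnergyInequality_of_frustrationFreeStars`, `metricDefectGap_of_localEnergyInequality`), where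
`LocalEnergyInequality` is the intermediate "any `R`-local, isometry-invariant, non-negative, lsc,
floored site functional with perfect zero set whose SUM IS DOMINATED by `E_χ − N e(Q₀)`" (exactness
weakened to an inequality: every Heitmann–Radin/Theil-style local energy inequality qualifies, not only
m-potentials).  So every certificate programme of the idea (germ SDP j015598, star-form LP) still feeds
the registered stub, and the stub states exactly the open content: finite-range energetic
crystallization for `V_χ` in `d = 3` in its metric-defect-priced form (contains: every periodic
`V_χ`-minimiser, if any, is `(1/1000)`-locally Barlow; near-minimisers have few metric defects).

STUBS (registered after r3; each `sorry` is a genuine lemma of the line):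
* `stub_metricDefectGap`      — THE CORE (XL, hardest, the only `sorry`): the metric defect gap above.
* CLOSED, wired to the landed theorems: `stub_periodicStability` (p84999), `stub_knabeCompactness`
  (p85371), `stub_barlowWindowLink` (p85249), `stub_chargeFreeOpenAtGerm` (p85261).
* `TruncatedCensusGap_of`     — the kernel-checked composition (no `sorry`): hypothesis
  `Registered.stub_metricDefectGap`, conclusion the route decl BY NAME.

DISPROOF USED (`Cruxes/TruncatedCensusGap/Disproof.lean`, cdisprove g2, unchanged since 2026-08-15T23:17Z,
re-read by this seat).  `truncatedCensusGap_false_without_injective` (Negative/WithoutInjective):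
honoured — the stub is stated under `Function.Injective y` (and is FALSE without it by the same
two-poles witness, since germ-matching, like charge, is blind to the energy density).
`truncatedCensusGap_bddBelow` / `…_kappa_zero_iff_bddBelow` (Negative/KappaZeroHalf): honoured — the
stub uses `e_χ*` only UPWARD (it is downward closed in `e_χ*` exactly like the crux), `BddBelow` is the
landed p84999 and is needed only by the bridge from `LocalEnergyInequality` (`ciInf_le`).  §6 ceiling
(`κ ≤ 2.7e-5` for the crux): the stub's κ is smaller still and is never named — a homogeneous shear
`γ ≳ 7·10⁻⁴` of hcp* (`a* = 0.977069`, `c/a = 1.631418`, `e_χ(hcp*) = −0.608669048`) leaves a residual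
`1.5γa > a/1000` against every rigid Barlow germ on the `3a`-ball, so EVERY interior site is a metric
defect, at the elastic price `Δe = 1.23γ² ≈ 6·10⁻⁷` per site (this seat, `tmp/shear.py`): any valid κ of
the stub is `≤ 6·10⁻⁷`, conditional on `e_χ* = e_χ(hcp*)` exactly as the Disproof's ceilings are.
§7 near-miss (periodic pricing): not used.  `-- Targets`: none filed.

LANDED FROM THIS SKELETON (r3): `Theorems/PricedLinkCensusTruncatedCensusGapMetricDefectReduction.lean`
(p122076 ACCEPTED): `isChargeFree_of_germMatched_barlow` (open margin at explicit precision `1/1000`),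
`card_charged_le_card_not_germMatched`, `truncatedCensusGap_of_metricDefectGap` (= the composition below,
importable: the registered stub's statement → the crux), `truncatedCensusGap_of_localEnergyInequality`
(any dominated local functional with the six Knabe properties → the crux).
-/

noncomputable section

namespace Summit.AtomisticToContinuum.Crystallization.Cruxes.TruncatedCensusGap.FrustrationFreeCensusGerm

open Literature.MathematicalPhysics.StatisticalMechanics Literature.Geometry.DiscreteGeometry
open Summit.AtomisticToContinuum.Crystallization.Theses.PricedLinkCensus (TruncatedCensusGap)

/-! ## §0 Objects of the crux -/

/-- The range-2 truncated Lennard-Jones potential of the crux, `V_χ = χ · V_LJ`,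
`χ(r) = min 1 (max 0 (4 − 2r))`. -/
def Vχ (r : ℝ) : ℝ := min 1 (max 0 (4 - 2 * r)) * lennardJones r

/-- `e_χ* = ⨅` over periodic configurations of the `V_χ` energy per particle. -/
def eStar : ℝ := ⨅ Q : PeriodicConfiguration 3, Q.energyPerParticle Vχ

/-- The crux at a fixed price `κ` (same shape as `Disproof.GapAt`). -/
def GapAt (κ : ℝ) : Prop :=
  ∀ (N : ℕ) (y : Fin N → EuclideanSpace ℝ (Fin 3)), Function.Injective y →
    (N : ℝ) * eStar
      + κ * (Nat.card {i : Fin N // ¬ IsChargeFree (1 / 100 : ℝ) y i} : ℝ)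
      ≤ interactionEnergy Vχ y

/-- `TruncatedCensusGap ↔ ∃ κ > 0, GapAt κ` — definitional (the route decl, by name). -/
theorem tcg_iff : TruncatedCensusGap ↔ ∃ κ : ℝ, 0 < κ ∧ GapAt κ := Iff.rfl

/-- Beyond `r = 2` the truncated potential vanishes. -/
theorem Vχ_eq_zero {r : ℝ} (hr : 2 ≤ r) : Vχ r = 0 := by
  have h : max 0 (4 - 2 * r) = 0 := max_eq_left (by linarith)
  simp [Vχ, h]

/-! ## §1 Site functionals and star forms (the idea's architecture; after r3 a PROVED route in) -/

/-- A site functional: a real number for each site of each finite configuration of `ℝ³`. -/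
abbrev SiteFunctional : Type :=
  (N : ℕ) → (Fin N → EuclideanSpace ℝ (Fin 3)) → Fin N → ℝ

/-- A pair-weight system: `w N y i j k` is the share of the root `i` in the pair `{j, k}`
(`j < k`) of the configuration `y`. -/
abbrev WeightSystem : Type :=
  (N : ℕ) → (Fin N → EuclideanSpace ℝ (Fin 3)) → Fin N → Fin N → Fin N → ℝ

/-- A mass-weight system: `μ N y i j` is the share of the root `i` in the reference-energy
budget `e₀` of the site `j`. -/
abbrev MassSystem : Type :=
  (N : ℕ) → (Fin N → EuclideanSpace ℝ (Fin 3)) → Fin N → Fin N → ℝ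

/-- The STAR FORM of root `i`: its weighted share of all pair energies, minus its weighted
share of the reference budget `N · e₀`. -/
def starForm (w : WeightSystem) (μ : MassSystem) (e₀ : ℝ) : SiteFunctional := fun N y i =>
  (∑ j : Fin N, ∑ k ∈ Finset.Ioi j, w N y i j k * Vχ (dist (y j) (y k)))
    - e₀ * ∑ j : Fin N, μ N y i j

/-- EXACT, SIGN-ONLY reapportioning: non-negative pair weights summing to one over the roots on
every interacting pair (`dist < 2`), non-negative mass weights summing to one over the roots at
every site — so that nothing is lost or created (`sum_starForm`: `Σ_i h_i = E_χ − N e₀`). -/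
def IsReapportioning (w : WeightSystem) (μ : MassSystem) : Prop :=
  ∀ (N : ℕ) (y : Fin N → EuclideanSpace ℝ (Fin 3)), Function.Injective y →
    (∀ j k : Fin N, j < k →
      (∀ i : Fin N, 0 ≤ w N y i j k) ∧ (dist (y j) (y k) < 2 → ∑ i : Fin N, w N y i j k = 1)) ∧
    (∀ j : Fin N, (∀ i : Fin N, 0 ≤ μ N y i j) ∧ ∑ i : Fin N, μ N y i j = 1)

/-- LOCALITY of radius `R`: the value at a root is unchanged when every site farther than `R`
from the root is deleted and the remaining sites are relabelled. -/
def IsLocal (h : SiteFunctional) (R : ℝ) : Prop :=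
  ∀ (N M : ℕ) (y : Fin N → EuclideanSpace ℝ (Fin 3)) (f : Fin M ↪ Fin N) (i : Fin M),
    (∀ j : Fin N, dist (y j) (y (f i)) ≤ R → j ∈ Set.range f) →
    h M (y ∘ f) i = h N y (f i)

/-- Invariance under rigid motions (and reflections) of `ℝ³`. -/
def IsIsometryInvariant (h : SiteFunctional) : Prop :=
  ∀ (N : ℕ) (y : Fin N → EuclideanSpace ℝ (Fin 3)) (i : Fin N)
    (g : EuclideanSpace ℝ (Fin 3) ≃ᵢ EuclideanSpace ℝ (Fin 3)), h N (g ∘ y) i = h N y i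

/-- FRUSTRATION-FREENESS (sign): every local term is non-negative on every finite injective
configuration. -/
def IsNonneg (h : SiteFunctional) : Prop :=
  ∀ (N : ℕ) (y : Fin N → EuclideanSpace ℝ (Fin 3)) (i : Fin N), Function.Injective y →
    0 ≤ h N y i

/-- Lower semicontinuity in the positions, at injective configurations. -/
def IsLowerSemicontinuous (h : SiteFunctional) : Prop :=
  ∀ (N : ℕ) (y : Fin N → EuclideanSpace ℝ (Fin 3)) (i : Fin N), Function.Injective y →
    LowerSemicontinuousAt (fun y' : Fin N → EuclideanSpace ℝ (Fin 3) => h N y' i) y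

/-- CROWDING FLOOR: a root that sees two sites closer than `r₀` to each other inside its `R`-ball
carries at least `h₀`. -/
def HasCrowdingFloor (h : SiteFunctional) (R r₀ h₀ : ℝ) : Prop :=
  ∀ (N : ℕ) (y : Fin N → EuclideanSpace ℝ (Fin 3)) (i : Fin N), Function.Injective y →
    (∃ j k : Fin N, j ≠ k ∧ dist (y j) (y i) ≤ R ∧ dist (y k) (y i) ≤ R ∧
        dist (y j) (y k) < r₀) →
    h₀ ≤ h N y i

/-- DOMINATION BY THE EXCESS ENERGY (r3; exactness weakened to an inequality): on every finite
injective configuration the site values sum to at most `E_χ(y) − N · e₀`. -/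
def IsDominated (h : SiteFunctional) (e₀ : ℝ) : Prop :=
  ∀ (N : ℕ) (y : Fin N → EuclideanSpace ℝ (Fin 3)), Function.Injective y →
    ∑ i, h N y i ≤ interactionEnergy Vχ y - (N : ℝ) * e₀

/-! ## §2 Close-packed germs: metric defects, the zero set -/

/-- `δ`-GERM-MATCHED: the configuration within `3a` of the site `i` is `a/2`-separated and
two-way `δa`-matched to a rigid image of a Barlow stacking `barlowStacking a c s` (any scale
`a > 0`, any Hägg word `s`, layer spacing `c` within `1/250` of the ideal `a√(2/3)`).  A site that is
NOT `δ`-germ-matched is a METRIC DEFECT at precision `δ`. -/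
def GermMatched (δ : ℝ) {N : ℕ} (y : Fin N → EuclideanSpace ℝ (Fin 3)) (i : Fin N) : Prop :=
  ∃ (a c : ℝ) (s : ℤ → ℤ)
    (g : EuclideanSpace ℝ (Fin 3) ≃ᵃⁱ[ℝ] EuclideanSpace ℝ (Fin 3)),
    0 < a ∧ IsHaggSeq s ∧ |c - a * Real.sqrt (2 / 3)| ≤ a * Real.sqrt (2 / 3) / 250 ∧
    (∀ j k : Fin N, j ≠ k → dist (y j) (y i) ≤ 3 * a → a / 2 ≤ dist (y j) (y k)) ∧
    (∀ j : Fin N, dist (y j) (y i) ≤ 3 * a →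
        ∃ z ∈ barlowStacking a c s, dist (y j) (g z) ≤ δ * a) ∧
    (∀ z ∈ barlowStacking a c s, dist (g z) (y i) ≤ 3 * a →
        ∃ j : Fin N, dist (y j) (g z) ≤ δ * a)

/-- PERFECT GERM of radius `4a ≤ R`: the configuration within `4a` of the site `i` IS a rigid
image of a Barlow stacking there (exact two-way correspondence; spacing in the window). -/
def PerfectGerm (R : ℝ) {N : ℕ} (y : Fin N → EuclideanSpace ℝ (Fin 3)) (i : Fin N) : Prop :=
  ∃ (a c : ℝ) (s : ℤ → ℤ)
    (g : EuclideanSpace ℝ (Fin 3) ≃ᵃⁱ[ℝ] EuclideanSpace ℝ (Fin 3)),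
    0 < a ∧ 4 * a ≤ R ∧ IsHaggSeq s ∧
    |c - a * Real.sqrt (2 / 3)| ≤ a * Real.sqrt (2 / 3) / 250 ∧
    (∀ j : Fin N, dist (y j) (y i) ≤ 4 * a → ∃ z ∈ barlowStacking a c s, y j = g z) ∧
    (∀ z ∈ barlowStacking a c s, dist (g z) (y i) ≤ 4 * a → ∃ j : Fin N, y j = g z)

/-- SHARP ZERO SET: a local term vanishes (at an injective configuration) only on a perfect
germ that fits inside its locality radius. -/
def HasPerfectZeroSet (h : SiteFunctional) (R : ℝ) : Prop :=
  ∀ (N : ℕ) (y : Fin N → EuclideanSpace ℝ (Fin 3)) (i : Fin N), Function.Injective y →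
    h N y i = 0 → PerfectGerm R y i

/-! ## §3 The statements (named; the open one is definitionally the type of `stub_metricDefectGap`) -/

/-- STATEMENT of `stub_periodicStability` (CLOSED, p84999) — periodic stability of `V_χ`. -/
def PeriodicStability : Prop :=
  BddBelow (Set.range fun Q : PeriodicConfiguration 3 => Q.energyPerParticle Vχ)

/-- **STATEMENT of `stub_metricDefectGap` — THE METRIC DEFECT GAP (the core after r3; hardest; the
only open stub).**  There is `κ > 0` such that every finite injective configuration pays, above
`N · e_χ*`, at least `κ` for every site that is not `(1/1000)`-germ-matched (two-way `(a/1000)`-matching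
within `3a` to a rigid image of some `barlowStacking a c s`, `a > 0` free, `s` Hägg, spacing window
`±1/250`, `a/2`-separation).  It is the crux with the bond-graph defect notion replaced by the metric
one; by the landed open margin (`isChargeFree_of_germMatched_fin`) it implies the crux, and it is implied
by r2's frustration-free star forms (`metricDefectGap_of_frustrationFreeStars`).  Declared content:
finite-range energetic crystallization for `V_χ` in `d = 3`, defect-priced (open). -/
def MetricDefectGap : Prop :=
  ∃ κ : ℝ, 0 < κ ∧
    ∀ (N : ℕ) (y : Fin N → EuclideanSpace ℝ (Fin 3)), Function.Injective y →
      (N : ℝ) * eStar + κ * (Nat.card {i : Fin N // ¬ GermMatched (1 / 1000) y i} : ℝ)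
        ≤ interactionEnergy Vχ y

/-- STATEMENT `LocalEnergyInequality` (r3 intermediate, NOT a stub; a proved route into
`MetricDefectGap`): some `R`-local, isometry-invariant, non-negative, lower semicontinuous site
functional with a crowding floor and a perfect zero set is dominated in sum by `E_χ − N e_χ(Q₀)` for
some periodic `Q₀`.  Weaker than r2's `FrustrationFreeStars` (exactness ⇒ domination). -/
def LocalEnergyInequality : Prop :=
  ∃ (h : SiteFunctional) (Q₀ : PeriodicConfiguration 3) (R r₀ h₀ : ℝ),
    0 < r₀ ∧ 0 < h₀ ∧
    IsLocal h R ∧ IsIsometryInvariant h ∧ IsNonneg h ∧ IsLowerSemicontinuous h ∧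
    HasCrowdingFloor h R r₀ h₀ ∧ HasPerfectZeroSet h R ∧
    IsDominated h (Q₀.energyPerParticle Vχ)

/-- STATEMENT of r2's `stub_frustrationFreeStars` (no longer registered; a proved route into
`MetricDefectGap`): unit-sum non-negative weights whose star forms at `e₀ = e_χ(Q₀)` are `R`-local,
isometry-invariant, non-negative, lsc, floored, with perfect zero set. -/
def FrustrationFreeStars : Prop :=
  ∃ (w : WeightSystem) (μ : MassSystem) (Q₀ : PeriodicConfiguration 3) (R r₀ h₀ : ℝ),
    0 < r₀ ∧ 0 < h₀ ∧ IsReapportioning w μ ∧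
    IsLocal (starForm w μ (Q₀.energyPerParticle Vχ)) R ∧
    IsIsometryInvariant (starForm w μ (Q₀.energyPerParticle Vχ)) ∧
    IsNonneg (starForm w μ (Q₀.energyPerParticle Vχ)) ∧
    IsLowerSemicontinuous (starForm w μ (Q₀.energyPerParticle Vχ)) ∧
    HasCrowdingFloor (starForm w μ (Q₀.energyPerParticle Vχ)) R r₀ h₀ ∧
    HasPerfectZeroSet (starForm w μ (Q₀.energyPerParticle Vχ)) R

/-- STATEMENT of `stub_knabeCompactness` (CLOSED, p85371) — local criterion ⇒ uniform price off the
`δ`-germ-matched sites, for every `δ ∈ (0, 1/2]`. -/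
def KnabeCompactness : Prop :=
  ∀ (h : SiteFunctional) (R r₀ h₀ : ℝ), 0 < r₀ → 0 < h₀ →
    IsLocal h R → IsIsometryInvariant h → IsNonneg h → IsLowerSemicontinuous h →
    HasCrowdingFloor h R r₀ h₀ → HasPerfectZeroSet h R →
    ∀ δ : ℝ, 0 < δ → δ ≤ 1 / 2 →
      ∃ κ : ℝ, 0 < κ ∧
        ∀ (N : ℕ) (y : Fin N → EuclideanSpace ℝ (Fin 3)) (i : Fin N),
          Function.Injective y → ¬ GermMatched δ y i → κ ≤ h N y i

/-- STATEMENT of `stub_barlowWindowLink` (CLOSED, p85249) — first shell and 4-regular link of every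
Barlow stacking on the spacing window `c ∈ [0.81a, 0.85a]`. -/
def BarlowWindowLink : Prop :=
  ∀ (a c : ℝ) (s : ℤ → ℤ), 0 < a → 81 / 100 * a ≤ c → c ≤ 17 / 20 * a → IsHaggSeq s →
    ∀ z₀ ∈ barlowStacking a c s,
      (∀ z ∈ barlowStacking a c s, z ≠ z₀ → dist z z₀ < 7 / 5 * a →
          dist z z₀ = a ∨ dist z z₀ = Real.sqrt (a ^ 2 / 3 + c ^ 2)) ∧
      {z ∈ barlowStacking a c s | z ≠ z₀ ∧ dist z z₀ < 7 / 5 * a}.ncard = 12 ∧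
      (∀ z ∈ barlowStacking a c s, z ≠ z₀ → dist z z₀ < 7 / 5 * a →
          {w ∈ barlowStacking a c s | w ≠ z₀ ∧ w ≠ z ∧ dist w z₀ < 7 / 5 * a ∧
              dist w z < 7 / 5 * a}.ncard = 4)

/-- STATEMENT of (the conclusion of) `stub_chargeFreeOpenAtGerm` (CLOSED, p85261) — for some
`δ ∈ (0, 1/2]`, `δ`-germ-matched ⇒ charge-free at tolerance `1/100`. -/
def ChargeFreeOpenAtGerm : Prop :=
  ∃ δ : ℝ, 0 < δ ∧ δ ≤ 1 / 2 ∧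
    ∀ (N : ℕ) (y : Fin N → EuclideanSpace ℝ (Fin 3)) (i : Fin N),
      GermMatched δ y i → IsChargeFree (1 / 100 : ℝ) y i

/-! ## §4 The stubs (SELF-CONTAINED signatures over tree declarations)

`stub_metricDefectGap` is the ONE registered open stub; its type spells out `MetricDefectGap` with
`Vχ`, `eStar`, `GermMatched` unfolded, so that the registered signature elaborates in a bare
`Theorems/` file with
`open Literature.MathematicalPhysics.StatisticalMechanics Literature.Geometry.DiscreteGeometry`.
The four closed stubs of r2 are kept, wired to their landed theorems. -/

/-- **Stub 1 (S) — CLOSED (p84999).** Periodic stability of `V_χ` = `PeriodicStability`. -/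
theorem stub_periodicStability :
    BddBelow (Set.range fun Q : PeriodicConfiguration 3 =>
      Q.energyPerParticle fun r => min 1 (max 0 (4 - 2 * r)) * lennardJones r) :=
  Summit.AtomisticToContinuum.Crystallization.Theorems.PricedLinkCensusTruncatedCensusGap.stub_periodicStability

example : PeriodicStability := stub_periodicStability

/-- **Stub 2′ (XL; LOAD-BEARING, hardest, the only open stub after r3) — THE METRIC DEFECT GAP**
= `MetricDefectGap` spelled out: `∃ κ > 0, ∀ N y injective,
N · e_χ* + κ · #{i | ¬ GermMatched (1/1000) y i} ≤ E_χ(y)`. -/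
theorem stub_metricDefectGap :
    ∃ κ : ℝ, 0 < κ ∧
      ∀ (N : ℕ) (y : Fin N → EuclideanSpace ℝ (Fin 3)), Function.Injective y →
        (N : ℝ) * (⨅ Q : PeriodicConfiguration 3,
            Q.energyPerParticle fun r => min 1 (max 0 (4 - 2 * r)) * lennardJones r)
          + κ * (Nat.card {i : Fin N //
              ¬ ∃ (a c : ℝ) (s : ℤ → ℤ)
                  (g : EuclideanSpace ℝ (Fin 3) ≃ᵃⁱ[ℝ] EuclideanSpace ℝ (Fin 3)),
                0 < a ∧ IsHaggSeq s ∧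
                |c - a * Real.sqrt (2 / 3)| ≤ a * Real.sqrt (2 / 3) / 250 ∧
                (∀ j k : Fin N, j ≠ k → dist (y j) (y i) ≤ 3 * a → a / 2 ≤ dist (y j) (y k)) ∧
                (∀ j : Fin N, dist (y j) (y i) ≤ 3 * a →
                    ∃ z ∈ barlowStacking a c s, dist (y j) (g z) ≤ 1 / 1000 * a) ∧
                (∀ z ∈ barlowStacking a c s, dist (g z) (y i) ≤ 3 * a →
                    ∃ j : Fin N, dist (y j) (g z) ≤ 1 / 1000 * a)} : ℝ)
          ≤ interactionEnergy (fun r => min 1 (max 0 (4 - 2 * r)) * lennardJones r) y := by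
  sorry

example : MetricDefectGap := stub_metricDefectGap

/-- **Stub 3 (M–L) — CLOSED (p85371).** Knabe-type compactness = `KnabeCompactness`. -/
theorem stub_knabeCompactness :
    ∀ (h : (N : ℕ) → (Fin N → EuclideanSpace ℝ (Fin 3)) → Fin N → ℝ) (R r₀ h₀ : ℝ),
      0 < r₀ → 0 < h₀ →
      (∀ (N M : ℕ) (y : Fin N → EuclideanSpace ℝ (Fin 3)) (f : Fin M ↪ Fin N) (i : Fin M),
        (∀ j : Fin N, dist (y j) (y (f i)) ≤ R → j ∈ Set.range f) →
        h M (y ∘ f) i = h N y (f i)) →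
      (∀ (N : ℕ) (y : Fin N → EuclideanSpace ℝ (Fin 3)) (i : Fin N)
        (g : EuclideanSpace ℝ (Fin 3) ≃ᵢ EuclideanSpace ℝ (Fin 3)), h N (g ∘ y) i = h N y i) →
      (∀ (N : ℕ) (y : Fin N → EuclideanSpace ℝ (Fin 3)) (i : Fin N), Function.Injective y →
        0 ≤ h N y i) →
      (∀ (N : ℕ) (y : Fin N → EuclideanSpace ℝ (Fin 3)) (i : Fin N), Function.Injective y →
        LowerSemicontinuousAt (fun y' : Fin N → EuclideanSpace ℝ (Fin 3) => h N y' i) y) →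
      (∀ (N : ℕ) (y : Fin N → EuclideanSpace ℝ (Fin 3)) (i : Fin N), Function.Injective y →
        (∃ j k : Fin N, j ≠ k ∧ dist (y j) (y i) ≤ R ∧ dist (y k) (y i) ≤ R ∧
            dist (y j) (y k) < r₀) →
        h₀ ≤ h N y i) →
      (∀ (N : ℕ) (y : Fin N → EuclideanSpace ℝ (Fin 3)) (i : Fin N), Function.Injective y →
        h N y i = 0 →
        ∃ (a c : ℝ) (s : ℤ → ℤ)
            (g : EuclideanSpace ℝ (Fin 3) ≃ᵃⁱ[ℝ] EuclideanSpace ℝ (Fin 3)),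
          0 < a ∧ 4 * a ≤ R ∧ IsHaggSeq s ∧
          |c - a * Real.sqrt (2 / 3)| ≤ a * Real.sqrt (2 / 3) / 250 ∧
          (∀ j : Fin N, dist (y j) (y i) ≤ 4 * a → ∃ z ∈ barlowStacking a c s, y j = g z) ∧
          (∀ z ∈ barlowStacking a c s, dist (g z) (y i) ≤ 4 * a → ∃ j : Fin N, y j = g z)) →
      ∀ δ : ℝ, 0 < δ → δ ≤ 1 / 2 →
        ∃ κ : ℝ, 0 < κ ∧
          ∀ (N : ℕ) (y : Fin N → EuclideanSpace ℝ (Fin 3)) (i : Fin N),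
            Function.Injective y →
            ¬ (∃ (a c : ℝ) (s : ℤ → ℤ)
                  (g : EuclideanSpace ℝ (Fin 3) ≃ᵃⁱ[ℝ] EuclideanSpace ℝ (Fin 3)),
                0 < a ∧ IsHaggSeq s ∧
                |c - a * Real.sqrt (2 / 3)| ≤ a * Real.sqrt (2 / 3) / 250 ∧
                (∀ j k : Fin N, j ≠ k → dist (y j) (y i) ≤ 3 * a → a / 2 ≤ dist (y j) (y k)) ∧
                (∀ j : Fin N, dist (y j) (y i) ≤ 3 * a →
                    ∃ z ∈ barlowStacking a c s, dist (y j) (g z) ≤ δ * a) ∧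
                (∀ z ∈ barlowStacking a c s, dist (g z) (y i) ≤ 3 * a →
                    ∃ j : Fin N, dist (y j) (g z) ≤ δ * a)) →
            κ ≤ h N y i :=
  Summit.AtomisticToContinuum.Crystallization.Theorems.PricedLinkCensusTruncatedCensusGap.stub_knabeCompactness

example : KnabeCompactness := stub_knabeCompactness

/-- **Stub 4 (M–L) — CLOSED (p85249).** The first shell and its 4-regular link on the spacing window
= `BarlowWindowLink`. -/
theorem stub_barlowWindowLink :
    ∀ (a c : ℝ) (s : ℤ → ℤ), 0 < a → 81 / 100 * a ≤ c → c ≤ 17 / 20 * a → IsHaggSeq s →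
      ∀ z₀ ∈ barlowStacking a c s,
        (∀ z ∈ barlowStacking a c s, z ≠ z₀ → dist z z₀ < 7 / 5 * a →
            dist z z₀ = a ∨ dist z z₀ = Real.sqrt (a ^ 2 / 3 + c ^ 2)) ∧
        {z ∈ barlowStacking a c s | z ≠ z₀ ∧ dist z z₀ < 7 / 5 * a}.ncard = 12 ∧
        (∀ z ∈ barlowStacking a c s, z ≠ z₀ → dist z z₀ < 7 / 5 * a →
            {w ∈ barlowStacking a c s | w ≠ z₀ ∧ w ≠ z ∧ dist w z₀ < 7 / 5 * a ∧
                dist w z < 7 / 5 * a}.ncard = 4) :=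
  Summit.AtomisticToContinuum.Crystallization.Theorems.PricedLinkCensusTruncatedCensusGap.stub_barlowWindowLink

example : BarlowWindowLink := stub_barlowWindowLink

/-- **Stub 5 (M–L) — CLOSED (p85261).** Charge-freeness is open at close-packed germs
= `BarlowWindowLink → ChargeFreeOpenAtGerm`. -/
theorem stub_chargeFreeOpenAtGerm :
    (∀ (a c : ℝ) (s : ℤ → ℤ), 0 < a → 81 / 100 * a ≤ c → c ≤ 17 / 20 * a → IsHaggSeq s →
      ∀ z₀ ∈ barlowStacking a c s,
        (∀ z ∈ barlowStacking a c s, z ≠ z₀ → dist z z₀ < 7 / 5 * a →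
            dist z z₀ = a ∨ dist z z₀ = Real.sqrt (a ^ 2 / 3 + c ^ 2)) ∧
        {z ∈ barlowStacking a c s | z ≠ z₀ ∧ dist z z₀ < 7 / 5 * a}.ncard = 12 ∧
        (∀ z ∈ barlowStacking a c s, z ≠ z₀ → dist z z₀ < 7 / 5 * a →
            {w ∈ barlowStacking a c s | w ≠ z₀ ∧ w ≠ z ∧ dist w z₀ < 7 / 5 * a ∧
                dist w z < 7 / 5 * a}.ncard = 4)) →
    ∃ δ : ℝ, 0 < δ ∧ δ ≤ 1 / 2 ∧
      ∀ (N : ℕ) (y : Fin N → EuclideanSpace ℝ (Fin 3)) (i : Fin N),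
        (∃ (a c : ℝ) (s : ℤ → ℤ)
            (g : EuclideanSpace ℝ (Fin 3) ≃ᵃⁱ[ℝ] EuclideanSpace ℝ (Fin 3)),
          0 < a ∧ IsHaggSeq s ∧ |c - a * Real.sqrt (2 / 3)| ≤ a * Real.sqrt (2 / 3) / 250 ∧
          (∀ j k : Fin N, j ≠ k → dist (y j) (y i) ≤ 3 * a → a / 2 ≤ dist (y j) (y k)) ∧
          (∀ j : Fin N, dist (y j) (y i) ≤ 3 * a →
              ∃ z ∈ barlowStacking a c s, dist (y j) (g z) ≤ δ * a) ∧
          (∀ z ∈ barlowStacking a c s, dist (g z) (y i) ≤ 3 * a →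
              ∃ j : Fin N, dist (y j) (g z) ≤ δ * a)) →
        IsChargeFree (1 / 100 : ℝ) y i :=
  Summit.AtomisticToContinuum.Crystallization.Theorems.PricedLinkCensusTruncatedCensusGap.stub_chargeFreeOpenAtGerm

example : BarlowWindowLink → ChargeFreeOpenAtGerm := stub_chargeFreeOpenAtGerm

/-! ## Name-keyed alias of the open statement (the hypothesis of the composition) -/
namespace Registered

/-- Alias of `MetricDefectGap` keyed by the registered stub name. -/
abbrev stub_metricDefectGap : Prop := MetricDefectGap

end Registered

/-! ## §5 Proved glue and the bridges r2 → r3 -/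

/-- **The open margin at the explicit precision `1/1000`** (the constant inside the landed p85261,
re-derived here from its exported lemmas `germ_window_bounds`, `isChargeFree_of_germMatched` and the
landed window link p85249): a `(1/1000)`-germ-matched site is charge-free at tolerance `1/100`.
Hence every CHARGED site is a metric defect at precision `1/1000`. -/
theorem isChargeFree_of_germMatched_fin {N : ℕ} {y : Fin N → EuclideanSpace ℝ (Fin 3)} {i : Fin N}
    (hgm : GermMatched (1 / 1000) y i) : IsChargeFree (1 / 100 : ℝ) y i := by
  obtain ⟨a, c, s, g, ha, hs, hc, hsep, hM1, hM2⟩ := hgm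
  obtain ⟨hc1, hc2, hl1, hl2⟩ :=
    Theorems.PricedLinkCensusTruncatedCensusGap.germ_window_bounds ha hc
  have hW' := stub_barlowWindowLink a c s ha hc1 hc2 hs
  rw [← isChargeFree_comp_isometry_iff g.symm.isometry (1 / 100 : ℝ) y i]
  have hdyy : ∀ j k, dist ((⇑g.symm ∘ y) j) ((⇑g.symm ∘ y) k) = dist (y j) (y k) := fun j k =>
    g.symm.dist_map (y j) (y k)
  have hdyz : ∀ j z, dist ((⇑g.symm ∘ y) j) z = dist (y j) (g z) := fun j z => by
    rw [Function.comp_apply, ← g.symm.dist_map (y j) (g z), g.symm_apply_apply]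
  refine Theorems.PricedLinkCensusTruncatedCensusGap.isChargeFree_of_germMatched
    (T := barlowStacking a c s) ha ?_ ?_
    (fun z₀ hz₀ => (hW' z₀ hz₀).2.1) (fun z₀ hz₀ => (hW' z₀ hz₀).2.2) ?_ ?_ ?_
  · intro z hz w hw hne
    have h1 := le_dist_of_mem_barlowStacking a c s ha.le (by linarith) hz hw hne
    have h2 : 81 / 100 * a ≤ min a c := le_min (by linarith) hc1
    linarith
  · intro z₀ hz₀ z hz hne hd
    rcases (hW' z₀ hz₀).1 z hz hne hd with h | h <;> rw [h]
    · constructor <;> linarith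
    · exact ⟨hl1, hl2⟩
  · intro j k hjk hj
    rw [hdyy] at hj ⊢
    exact hsep j k hjk hj
  · intro j hj
    rw [hdyy] at hj
    obtain ⟨z, hz, hd⟩ := hM1 j hj
    exact ⟨z, hz, by rw [hdyz]; exact hd⟩
  · intro z hz hd
    rw [dist_comm, hdyz, dist_comm] at hd
    obtain ⟨j, hj⟩ := hM2 z hz hd
    exact ⟨j, by rw [hdyz]; exact hj⟩

/-- **Counting.**  Charged sites are metric defects at precision `1/1000`, so there are no more
charged sites than metric defects. -/
theorem card_charged_le_card_defect {N : ℕ} (y : Fin N → EuclideanSpace ℝ (Fin 3)) :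
    Nat.card {i : Fin N // ¬ IsChargeFree (1 / 100 : ℝ) y i} ≤
      Nat.card {i : Fin N // ¬ GermMatched (1 / 1000) y i} := by
  classical
  rw [Nat.card_eq_fintype_card, Nat.card_eq_fintype_card, Fintype.card_subtype,
    Fintype.card_subtype]
  exact Finset.card_le_card (Finset.monotone_filter_right _ fun i _ hi hgm =>
    hi (isChargeFree_of_germMatched_fin hgm))

/-- **Exactness of star forms** (r2).  Unit-sum weights lose nothing: `Σ_i h_i(y) = E_χ(y) − N · e₀`. -/
theorem sum_starForm {w : WeightSystem} {μ : MassSystem} (hw : IsReapportioning w μ) (e₀ : ℝ)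
    {N : ℕ} {y : Fin N → EuclideanSpace ℝ (Fin 3)} (hy : Function.Injective y) :
    ∑ i, starForm w μ e₀ N y i = interactionEnergy Vχ y - (N : ℝ) * e₀ := by
  have hpair : ∀ j k : Fin N, k ∈ Finset.Ioi j →
      ∑ i, w N y i j k * Vχ (dist (y j) (y k)) = Vχ (dist (y j) (y k)) := by
    intro j k hk
    rw [← Finset.sum_mul]
    rcases lt_or_ge (dist (y j) (y k)) 2 with hlt | hge
    · rw [(((hw N y hy).1 j k (Finset.mem_Ioi.1 hk)).2 hlt), one_mul]
    · rw [Vχ_eq_zero hge, mul_zero]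
  have hmass : ∀ j : Fin N, ∑ i, μ N y i j = 1 := fun j => ((hw N y hy).2 j).2
  have hswap : ∑ i, ∑ j : Fin N, ∑ k ∈ Finset.Ioi j, w N y i j k * Vχ (dist (y j) (y k)) =
      ∑ j : Fin N, ∑ k ∈ Finset.Ioi j, ∑ i, w N y i j k * Vχ (dist (y j) (y k)) := by
    rw [Finset.sum_comm]
    refine Finset.sum_congr rfl fun j _ => ?_
    rw [Finset.sum_comm]
  have hswap' : ∑ i, e₀ * ∑ j : Fin N, μ N y i j = (N : ℝ) * e₀ := by
    rw [← Finset.mul_sum, Finset.sum_comm]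
    simp only [hmass, Finset.sum_const, Finset.card_univ, Fintype.card_fin, nsmul_eq_mul,
      mul_one]
    ring
  unfold starForm
  rw [Finset.sum_sub_distrib, hswap, hswap']
  unfold interactionEnergy
  congr 1
  exact Finset.sum_congr rfl fun j _ => Finset.sum_congr rfl fun k hk => hpair j k hk

/-- **Bookkeeping.**  A non-negative function on the sites that is `≥ κ` wherever a predicate `P`
fails sums to at least `κ · #{i | ¬ P i}`. -/
theorem mul_card_le_sum {N : ℕ} (P : Fin N → Prop) (f : Fin N → ℝ) (κ : ℝ)
    (hnn : ∀ i, 0 ≤ f i) (hP : ∀ i, ¬ P i → κ ≤ f i) :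
    κ * (Nat.card {i : Fin N // ¬ P i} : ℝ) ≤ ∑ i, f i := by
  classical
  have hcard : Nat.card {i : Fin N // ¬ P i} = (Finset.univ.filter fun i : Fin N => ¬ P i).card := by
    rw [Nat.card_eq_fintype_card, Fintype.card_subtype]
  have h1 : ((Finset.univ.filter fun i : Fin N => ¬ P i).card : ℝ) * κ ≤
      ∑ i ∈ Finset.univ.filter (fun i : Fin N => ¬ P i), f i := by
    have := Finset.card_nsmul_le_sum (Finset.univ.filter fun i : Fin N => ¬ P i) f κ
      (fun i hi => hP i (Finset.mem_filter.1 hi).2)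
    simpa [nsmul_eq_mul] using this
  have h2 : ∑ i ∈ Finset.univ.filter (fun i : Fin N => ¬ P i), f i ≤ ∑ i, f i :=
    Finset.sum_le_univ_sum_of_nonneg hnn
  rw [hcard]
  nlinarith [h1, h2, mul_comm κ ((Finset.univ.filter fun i : Fin N => ¬ P i).card : ℝ)]

/-- **Bridge 1 (r2 ⇒ r3 intermediate).**  Exact star forms are in particular dominated:
`FrustrationFreeStars → LocalEnergyInequality`. -/
theorem localEnergyInequality_of_frustrationFreeStars (H : FrustrationFreeStars) :
    LocalEnergyInequality := by
  obtain ⟨w, μ, Q₀, R, r₀, h₀, hr₀, hh₀, hw, hloc, hiso, hnn, hlsc, hfloor, hzero⟩ := H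
  refine ⟨starForm w μ (Q₀.energyPerParticle Vχ), Q₀, R, r₀, h₀, hr₀, hh₀, hloc, hiso, hnn, hlsc,
    hfloor, hzero, fun N y hy => ?_⟩
  rw [sum_starForm hw _ hy]

/-- **Bridge 2 (r3 intermediate ⇒ the registered stub).**  A dominated local functional with the
six Knabe properties prices metric defects at precision `1/1000` above `N · e_χ*`:
`LocalEnergyInequality → MetricDefectGap` (landed Knabe compactness p85371 at `δ = 1/1000`, landed
periodic stability p84999 for `e_χ* ≤ e_χ(Q₀)` by `ciInf_le`). -/
theorem metricDefectGap_of_localEnergyInequality (H : LocalEnergyInequality) : MetricDefectGap := by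
  obtain ⟨h, Q₀, R, r₀, h₀, hr₀, hh₀, hloc, hiso, hnn, hlsc, hfloor, hzero, hdom⟩ := H
  have h₃ : KnabeCompactness := stub_knabeCompactness
  obtain ⟨κ, hκ, hgap⟩ := h₃ h R r₀ h₀ hr₀ hh₀ hloc hiso hnn hlsc hfloor hzero (1 / 1000)
    (by norm_num) (by norm_num)
  refine ⟨κ, hκ, fun N y hy => ?_⟩
  have hB : BddBelow (Set.range fun Q : PeriodicConfiguration 3 => Q.energyPerParticle Vχ) :=
    stub_periodicStability
  have hle : eStar ≤ Q₀.energyPerParticle Vχ := ciInf_le hB Q₀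
  have hle' : (N : ℝ) * eStar ≤ (N : ℝ) * Q₀.energyPerParticle Vχ :=
    mul_le_mul_of_nonneg_left hle (Nat.cast_nonneg N)
  have hprice : κ * (Nat.card {i : Fin N // ¬ GermMatched (1 / 1000) y i} : ℝ) ≤ ∑ i, h N y i :=
    mul_card_le_sum (fun i => GermMatched (1 / 1000) y i) (fun i => h N y i) κ
      (fun i => hnn N y i hy) (fun i hi => hgap N y i hy hi)
  have hd := hdom N y hy
  linarith

/-- **Bridge r2 ⇒ r3.**  The r2 stub implies the r3 stub: `FrustrationFreeStars → MetricDefectGap`. -/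
theorem metricDefectGap_of_frustrationFreeStars (H : FrustrationFreeStars) : MetricDefectGap :=
  metricDefectGap_of_localEnergyInequality (localEnergyInequality_of_frustrationFreeStars H)

/-! ## §6 The composition: the one open stub implies the crux BY NAME -/

/-- **`TruncatedCensusGap` from the one open stub** (kernel-checked, no `sorry`): charged sites are
metric defects at precision `1/1000` (`card_charged_le_card_defect`, from the landed window link and
open margin), so the metric defect gap prices them. -/
theorem TruncatedCensusGap_of (h₂ : Registered.stub_metricDefectGap) :
    Summit.AtomisticToContinuum.Crystallization.Theses.PricedLinkCensus.TruncatedCensusGap := by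
  obtain ⟨κ, hκ, hgap⟩ := h₂
  rw [tcg_iff]
  refine ⟨κ, hκ, fun N y hy => ?_⟩
  have h1 := hgap N y hy
  have h2 : κ * (Nat.card {i : Fin N // ¬ IsChargeFree (1 / 100 : ℝ) y i} : ℝ) ≤
      κ * (Nat.card {i : Fin N // ¬ GermMatched (1 / 1000) y i} : ℝ) :=
    mul_le_mul_of_nonneg_left (by exact_mod_cast card_charged_le_card_defect y) hκ.le
  linarith

-- The same composition is LANDED as `Theorems.PricedLinkCensusTruncatedCensusGap.
-- truncatedCensusGap_of_metricDefectGap` (p122076; module `…Theorems.PricedLinkCensusTruncatedCensusGap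
-- MetricDefectReduction`, not imported here only to keep this workfile independent of farm build order):
-- the registered stub's statement is verbatim its hypothesis.

/-- Wiring check: the registered stub feeds `TruncatedCensusGap_of` as stated. -/
example : Summit.AtomisticToContinuum.Crystallization.Theses.PricedLinkCensus.TruncatedCensusGap :=
  TruncatedCensusGap_of stub_metricDefectGap

/-- Wiring check: the r2 programme (frustration-free star forms) still closes the crux, through the
proved bridges. -/
example (H : FrustrationFreeStars) :
    Summit.AtomisticToContinuum.Crystallization.Theses.PricedLinkCensus.TruncatedCensusGap :=
  TruncatedCensusGap_of (metricDefectGap_of_frustrationFreeStars H)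

/-- Wiring check: any dominated local energy inequality closes the crux. -/
example (H : LocalEnergyInequality) :
    Summit.AtomisticToContinuum.Crystallization.Theses.PricedLinkCensus.TruncatedCensusGap :=
  TruncatedCensusGap_of (metricDefectGap_of_localEnergyInequality H)

end Summit.AtomisticToContinuum.Crystallization.Cruxes.TruncatedCensusGap.FrustrationFreeCensusGerm

end
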